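import Summits.ValiantsHypothesis.ValiantsHypothesis.Theorems.GrenetZeonDualUnipotentThreeHalvesHeavyTopPatternSlow

/-!
# `GrenetZeon.DualUnipotentThreeHalves` (stmt-ValiantsHypothesis-24318), R2 / R2ᵖ instance grids — COORDINATE PATTERN PENCILS:
# trace-orthogonality of pattern pencils (`RadOrth` for EVERY `K`) and the path-placement criterion WITHOUT the bound `n ≤ 16`

Experiment cell «val-heavytop-census» (D-0160), engine seat val-htc-eng-2 (g2).  The criteria ✓ `not_heavyTopInst_of_placement` and
✓ `exists_not_slow_of_placement` carry the hypothesis `s + 1 ≤ 16`, used only to discharge the heavy-top hypothesis of `HeavyTopInst`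
(«every trace-orthogonal `K` has `dim K ≤ 16 m √n + 16 n`») by `dim K ≤ n² ≤ 16 n`.  This file records the exact trace-orthogonality
configuration of the witnesses and removes the bound:

* ★ `radOrth_patPencil` — for a strictly upper placement EVERY direction space `K` is `RadOrth`: the pencil algebra `pencilAlg N` is upper
  triangular (`Algebra.adjoin` of strictly upper tops ≤ `Matrix.blockTriangularSubalgebra`), the tops are strictly upper, so every trace
  `tr(N_lin(v) · b)` vanishes.  So for pattern pencils the heavy-top hypothesis is precisely the NUMERIC condition `n² ≤ 16 m √n + 16 n` —
  automatic for `n ≤ 16` AND throughout the sliver `m > m*_tri(n) ≈ n^{3/2}/√2` for every `n` (there `16 m √n > 11 n²`): the ✗ phenomenon of the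
  census rows is not an artefact of the vacuous range.
* `not_flagCheap_patPencil_placement`, `not_slow_patPencil_placement` — the cores of the two criteria with NO hypothesis on `n`
  (the pattern pencil of a path placement is neither flag-cheap nor slow);
* `not_heavyTopInst_of_placement_general`, `exists_not_slow_of_placement_general` — the criteria under
  `(s+1)² ≤ 16 m √(s+1) + 16 (s+1)` instead of `s + 1 ≤ 16`.

Honest framing.  `--supports stmt-ValiantsHypothesis-24318 --as helper`; calibration of the instance tables (every cell reachable by a placement has
`C₀(n,m) = 1`, director R324); nothing here bears on R2 / R2ᵖ / S3 as LAWS, the crux 24318, rung 8062 or `VP ≠ VNP` — all OPEN.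
[✓ `…HeavyTopPatternPlacement`, ✓ `…HeavyTopPatternSlow`; Mathlib `Matrix.blockTriangularSubalgebra`; this seat]
-/

-- `Summit.ValiantsHypothesis.ValiantsHypothesis.…` repeats a component (D-0017 layout); `dupNamespace` would flag the mandated name.
set_option linter.dupNamespace false
set_option autoImplicit false

noncomputable section

namespace Summit.ValiantsHypothesis.ValiantsHypothesis.Theorems.GrenetZeon.RadicalSplit

open MvPolynomial Matrix
open scoped BigOperators
open Summit.ValiantsHypothesis.ValiantsHypothesis.Cruxes.TwoDimCoefficients.DimTwoCases (AffMat IsAffine)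

/-! ## Trace-orthogonality of pattern pencils and the criterion for every `n` -/

section AnyN

open Summit.ValiantsHypothesis.ValiantsHypothesis.Theorems.GrenetZeon.SlowCore (Slow)

variable {n m s : ℕ}

/-- **Pattern pencils are trace-orthogonal to EVERYTHING**: for a strictly upper placement, every direction space `K` is `RadOrth` —
the pencil algebra is upper triangular (it is generated by strictly upper tops) and the tops are strictly upper, so every trace
`tr(N_lin(v) · b)` vanishes.  So for these witnesses the heavy-top hypothesis of `HeavyTopInst` is exactly the NUMERIC condition
`dim K ≤ 16 m √n + 16 n` for all `K`, i.e. `n² ≤ 16 m √n + 16 n` — automatic for `n ≤ 16` and throughout the sliver `m > m*_tri(n)`. -/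
theorem radOrth_patPencil (pos : Fin n × Fin n → Fin m × Fin m) (hup : ∀ c, (pos c).1 < (pos c).2)
    (K : Submodule ℂ (Fin n × Fin n → ℂ)) : RadOrth n m (patPencil pos) K := by
  classical
  intro v _ b hb
  have hbT : Matrix.BlockTriangular b id := by
    have hle : pencilAlg (patPencil pos) ≤ Matrix.blockTriangularSubalgebra ℂ ℂ (id : Fin m → Fin m) := by
      refine Algebra.adjoin_le ?_
      rintro _ ⟨x, rfl⟩
      rw [SetLike.mem_coe, Matrix.mem_blockTriangularSubalgebra]
      show ((patPencil pos).map (MvPolynomial.eval x)).BlockTriangular id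
      rw [patPencil_map_eval]
      intro i j hij
      exact patTop_apply_eq_zero_of_le pos hup _ (le_of_lt (Fin.lt_def.1 hij))
    exact Matrix.mem_blockTriangularSubalgebra.1 (hle hb)
  rw [linPart_patPencil, Matrix.trace]
  refine Finset.sum_eq_zero fun i _ => ?_
  rw [Matrix.diag_apply, Matrix.mul_apply]
  refine Finset.sum_eq_zero fun k _ => ?_
  by_cases hik : i < k
  · rw [hbT hik, mul_zero]
  · rw [patTop_apply_eq_zero_of_le pos hup _ (Fin.le_def.1 (not_lt.1 hik)), zero_mul]

/-- **The pattern pencil of a path placement is NOT FLAG-CHEAP** (no hypothesis on `n`): the core of ✓ `not_heavyTopInst_of_placement`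
(Lemma A + Lemma B + row-path counting), extracted. -/
theorem not_flagCheap_patPencil_placement (V : Fin (s + 1) → Fin (s + 1) → Fin m)
    (X : Fin (s + 1) → Fin m × Fin m) (hinj : Function.Injective (placement V X))
    (hup : ∀ c, (placement V X c).1 < (placement V X c).2) : ¬ FlagCheap (s + 1) m (patPencil (placement V X)) := by
  classical
  intro hFC
  set pos := placement V X with hpos
  rw [flagCheap_iff_wordTame _ (isAffine_patPencil pos)] at hFC
  obtain ⟨K, k, hdim, hW⟩ := hFC
  -- the words of length `≤ n − 1` with `> k` tops vanish on `K` …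
  have hK : ∀ x v : Fin (s + 1) × Fin (s + 1) → ℂ, v ∈ K →
      ∀ w ∈ {w : List Bool | w.length ≤ s + 1 - 1 ∧ k < w.count true}, word (patTop pos x) (patTop pos v) w = 0 := by
    intro x v hv w hw
    by_contra hne
    have h := hW x v hv
    rw [patPencil_map_eval, linPart_patPencil] at h
    exact not_wordTame_of_word _ _ w hne hw.2 hw.1 h
  -- … hence (Lemma A) on a coordinate set `E` with `dim K ≤ |E|`
  obtain ⟨E, hKE, hE⟩ := words_vanish_on_coordinate_of_vanish pos hinj hup K _ hK
  -- each row path meets `E` in at most `k` edges (Lemma B)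
  have hrow : ∀ a : Fin (s + 1),
      (Finset.univ.filter fun i : Fin s => ((a, i.castSucc) : Fin (s + 1) × Fin (s + 1)) ∈ E).card ≤ k := by
    intro a
    by_contra hlt
    push Not at hlt
    cases s with
    | zero => simp at hlt
    | succ s' =>
      have hch := isChain_rowPath V X a
      have hne : (List.ofFn fun i : Fin (s' + 1) => ((a, i.castSucc) : Fin (s' + 2) × Fin (s' + 2))) ≠ [] := by
        simp
      refine word_indicator_ne_zero_of_isChain pos E _ hne hch
        (hE (fun _ => 1) (fun d => if d ∈ E then 1 else 0) (fun c hc => if_neg hc) _ ⟨?_, ?_⟩)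
      · simp
      · rw [List.map_ofFn, count_true_ofFn]
        simpa using hlt
  -- so each fibre of `E` over the row index has at most `k + 1` elements …
  have hfib : ∀ a : Fin (s + 1), (E.filter fun c => c.1 = a).card ≤ k + 1 := by
    intro a
    have hsub : E.filter (fun c => c.1 = a) ⊆ insert (a, Fin.last s)
        ((Finset.univ.filter fun i : Fin s => ((a, i.castSucc) : Fin (s + 1) × Fin (s + 1)) ∈ E).image
          fun i => (a, i.castSucc)) := by
      intro c hc
      rw [Finset.mem_filter] at hc
      obtain ⟨hcE, hca⟩ := hc
      rw [Finset.mem_insert, Finset.mem_image]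
      rcases Fin.eq_castSucc_or_eq_last c.2 with ⟨i, hi⟩ | hlast
      · right
        have hci : c = (a, i.castSucc) := Prod.ext hca hi
        refine ⟨i, ?_, hci.symm⟩
        rw [Finset.mem_filter]
        exact ⟨Finset.mem_univ _, hci ▸ hcE⟩
      · left
        exact Prod.ext hca hlast
    calc (E.filter fun c => c.1 = a).card
        ≤ (insert (a, Fin.last s) ((Finset.univ.filter fun i : Fin s =>
            ((a, i.castSucc) : Fin (s + 1) × Fin (s + 1)) ∈ E).image fun i => (a, i.castSucc))).card :=
          Finset.card_le_card hsub
      _ ≤ ((Finset.univ.filter fun i : Fin s => ((a, i.castSucc) : Fin (s + 1) × Fin (s + 1)) ∈ E).image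
            fun i => (a, i.castSucc)).card + 1 := Finset.card_insert_le _ _
      _ ≤ (Finset.univ.filter fun i : Fin s => ((a, i.castSucc) : Fin (s + 1) × Fin (s + 1)) ∈ E).card + 1 :=
          Nat.add_le_add_right Finset.card_image_le 1
      _ ≤ k + 1 := Nat.add_le_add_right (hrow a) 1
  -- … and `|E| ≤ (s+1)(k+1)`, contradicting `(k+1)(s+1) < dim K ≤ |E|`
  have hcardE : E.card ≤ (s + 1) * (k + 1) := by
    calc E.card = ∑ a : Fin (s + 1), (E.filter fun c => c.1 = a).card :=
          Finset.card_eq_sum_card_fiberwise fun c _ => Finset.mem_univ c.1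
      _ ≤ ∑ _a : Fin (s + 1), (k + 1) := Finset.sum_le_sum fun a _ => hfib a
      _ = (s + 1) * (k + 1) := by simp
  have h3 : (k + 1) * (s + 1) = (s + 1) * (k + 1) := Nat.mul_comm _ _
  omega


/-- **The path-placement criterion for EVERY `n`**: the heavy-top hypothesis needs only the numeric inequality `(s+1)² ≤ 16 m √(s+1) + 16 (s+1)`
(trace-orthogonality holds for all `K`, `radOrth_patPencil`; the inequality is automatic in the sliver `m > m*_tri(s+1)` for every `s`). -/
theorem not_heavyTopInst_of_placement_general (hn : (s + 1) * (s + 1) ≤ 16 * m * Nat.sqrt (s + 1) + 16 * (s + 1))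
    (V : Fin (s + 1) → Fin (s + 1) → Fin m) (X : Fin (s + 1) → Fin m × Fin m) (hinj : Function.Injective (placement V X))
    (hup : ∀ c, (placement V X c).1 < (placement V X c).2) : ¬ HeavyTopInst (s + 1) m := by
  intro H
  refine not_flagCheap_patPencil_placement V X hinj hup
    (H _ (isAffine_patPencil _) (patPencil_pow_eq_zero _ hup) fun K _ => ?_)
  have h1 := Submodule.finrank_le K
  rw [Module.finrank_fintype_fun_eq_card, Fintype.card_prod, Fintype.card_fin] at h1
  exact h1.trans hn

/-- **The pattern pencil of a path placement is NOT SLOW** (no hypothesis on `n`): the core of ✓ `exists_not_slow_of_placement`, extracted. -/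
theorem not_slow_patPencil_placement (V : Fin (s + 1) → Fin (s + 1) → Fin m)
    (X : Fin (s + 1) → Fin m × Fin m) (hinj : Function.Injective (placement V X))
    (hup : ∀ c, (placement V X c).1 < (placement V X c).2) : ¬ Slow (s + 1) m (patPencil (placement V X)) := by
  classical
  set pos := placement V X with hpos
  rintro ⟨K, k, hK, hdim⟩
  -- the word sums with `j > k` tops (length `s`) vanish on `K`
  let 𝒮 : Set (Finset (List Bool)) :=
    {S | ∃ j, k < j ∧ S = (Finset.univ.filter fun f : Fin s → Bool => (List.ofFn f).count true = j).image List.ofFn}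
  have hK' : ∀ x v : Fin (s + 1) × Fin (s + 1) → ℂ, v ∈ K → ∀ S ∈ 𝒮,
      ∑ w ∈ S, word (patTop pos x) (patTop pos v) w = 0 := by
    rintro x v hv S ⟨j, hj, rfl⟩
    rw [Finset.sum_image fun f _ g _ h => List.ofFn_injective h]
    ext i i'
    have hdeg := hK x v hv i i'
    rw [patPencil_map_lineSubst, Nat.add_sub_cancel] at hdeg
    have hsum : ∑ i ∈ (Finsupp.single (0 : Fin 1) j).support, (Finsupp.single (0 : Fin 1) j) i = j := by
      rw [Finsupp.support_single _ (by omega : j ≠ 0), Finset.sum_singleton, Finsupp.single_eq_same]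
    have hcoeff := MvPolynomial.coeff_eq_zero_of_totalDegree_lt (d := Finsupp.single (0 : Fin 1) j)
      (lt_of_le_of_lt hdeg (by rw [hsum]; exact hj))
    rw [coeff_pow_line_eq_sum_gword] at hcoeff
    simpa [word_eq_gword] using hcoeff
  obtain ⟨E, hKE, hE⟩ := wordsums_vanish_on_coordinate_of_vanish pos hinj hup K 𝒮 hK'
  -- each row path meets `E` in at most `k` edges
  have hrow : ∀ a : Fin (s + 1),
      (Finset.univ.filter fun i : Fin s => ((a, i.castSucc) : Fin (s + 1) × Fin (s + 1)) ∈ E).card ≤ k := by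
    intro a
    by_contra hlt
    push Not at hlt
    have hs : 0 < s := by
      by_contra hs0
      have : s = 0 := by omega
      subst this
      simp at hlt
    have hcount : (List.ofFn fun i : Fin s => decide (((a, i.castSucc) : Fin (s + 1) × Fin (s + 1)) ∈ E)).count true =
        (Finset.univ.filter fun i : Fin s => ((a, i.castSucc) : Fin (s + 1) × Fin (s + 1)) ∈ E).card := by
      rw [count_true_ofFn]
      simp
    refine wordsum_indicator_ne_zero V X E a hs ?_
    have hmem : (Finset.univ.filter fun f : Fin s → Bool => (List.ofFn f).count true =
        (List.ofFn fun i : Fin s => decide (((a, i.castSucc) : Fin (s + 1) × Fin (s + 1)) ∈ E)).count true).image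
          List.ofFn ∈ 𝒮 := ⟨_, by rw [hcount]; exact hlt, rfl⟩
    have h := hE (fun _ => 1) (fun d => if d ∈ E then 1 else 0) (fun c hc => if_neg hc) _ hmem
    rwa [Finset.sum_image fun f _ g _ h => List.ofFn_injective h] at h
  -- fibres and the count, as in `not_heavyTopInst_of_placement`
  have hfib : ∀ a : Fin (s + 1), (E.filter fun c => c.1 = a).card ≤ k + 1 := by
    intro a
    have hsub : E.filter (fun c => c.1 = a) ⊆ insert (a, Fin.last s)
        ((Finset.univ.filter fun i : Fin s => ((a, i.castSucc) : Fin (s + 1) × Fin (s + 1)) ∈ E).image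
          fun i => (a, i.castSucc)) := by
      intro c hc
      rw [Finset.mem_filter] at hc
      obtain ⟨hcE, hca⟩ := hc
      rw [Finset.mem_insert, Finset.mem_image]
      rcases Fin.eq_castSucc_or_eq_last c.2 with ⟨i, hi⟩ | hlast
      · right
        have hci : c = (a, i.castSucc) := Prod.ext hca hi
        refine ⟨i, ?_, hci.symm⟩
        rw [Finset.mem_filter]
        exact ⟨Finset.mem_univ _, hci ▸ hcE⟩
      · left
        exact Prod.ext hca hlast
    calc (E.filter fun c => c.1 = a).card
        ≤ (insert (a, Fin.last s) ((Finset.univ.filter fun i : Fin s =>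
            ((a, i.castSucc) : Fin (s + 1) × Fin (s + 1)) ∈ E).image fun i => (a, i.castSucc))).card :=
          Finset.card_le_card hsub
      _ ≤ ((Finset.univ.filter fun i : Fin s => ((a, i.castSucc) : Fin (s + 1) × Fin (s + 1)) ∈ E).image
            fun i => (a, i.castSucc)).card + 1 := Finset.card_insert_le _ _
      _ ≤ (Finset.univ.filter fun i : Fin s => ((a, i.castSucc) : Fin (s + 1) × Fin (s + 1)) ∈ E).card + 1 :=
          Nat.add_le_add_right Finset.card_image_le 1
      _ ≤ k + 1 := Nat.add_le_add_right (hrow a) 1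
  have hcardE : E.card ≤ (s + 1) * (k + 1) := by
    calc E.card = ∑ a : Fin (s + 1), (E.filter fun c => c.1 = a).card :=
          Finset.card_eq_sum_card_fiberwise fun c _ => Finset.mem_univ c.1
      _ ≤ ∑ _a : Fin (s + 1), (k + 1) := Finset.sum_le_sum fun a _ => hfib a
      _ = (s + 1) * (k + 1) := by simp
  have h3 : (k + 1) * (s + 1) = (s + 1) * (k + 1) := Nat.mul_comm _ _
  omega


/-- **Power currency for EVERY `n`**: the `(s+1, m)` instance of R2ᵖ `HeavyTopSlowLaw` is false on a path placement as soon as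
`(s+1)² ≤ 16 m √(s+1) + 16 (s+1)`. -/
theorem exists_not_slow_of_placement_general (hn : (s + 1) * (s + 1) ≤ 16 * m * Nat.sqrt (s + 1) + 16 * (s + 1))
    (V : Fin (s + 1) → Fin (s + 1) → Fin m) (X : Fin (s + 1) → Fin m × Fin m) (hinj : Function.Injective (placement V X))
    (hup : ∀ c, (placement V X c).1 < (placement V X c).2) :
    ∃ N : AffMat (s + 1) m, IsAffine N ∧ N ^ m = 0 ∧
      (∀ K : Submodule ℂ (Fin (s + 1) × Fin (s + 1) → ℂ), RadOrth (s + 1) m N K →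
        Module.finrank ℂ K ≤ 16 * m * Nat.sqrt (s + 1) + 16 * (s + 1)) ∧ ¬ Slow (s + 1) m N := by
  refine ⟨patPencil (placement V X), isAffine_patPencil _, patPencil_pow_eq_zero _ hup, fun K _ => ?_,
    not_slow_patPencil_placement V X hinj hup⟩
  have h1 := Submodule.finrank_le K
  rw [Module.finrank_fintype_fun_eq_card, Fintype.card_prod, Fintype.card_fin] at h1
  exact h1.trans hn

end AnyN

end Summit.ValiantsHypothesis.ValiantsHypothesis.Theorems.GrenetZeon.RadicalSplit

end
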